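import Summits.NavierStokesRegularity.NavierStokesRegularity.Theses.SymmetryModuliCount
import Summits.NavierStokesRegularity.NavierStokesRegularity.Theses.DulacContraction
import Summits.NavierStokesRegularity.NavierStokesRegularity.Theorems.SymmetryModuliCountForcedSymmetryCollapse
import Summits.NavierStokesRegularity.NavierStokesRegularity.Theorems.RecurrentProfilesRecurrentReduction
import Summits.NavierStokesRegularity.NavierStokesRegularity.Theorems.RecurrentProfilesRecurrentReductionOrbit
import Summits.NavierStokesRegularity.NavierStokesRegularity.Theorems.SymmetryModuliCountForcedSymmetryRecurrentClosingResidual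
import Summits.NavierStokesRegularity.NavierStokesRegularity.Theorems.SymmetryModuliCountForcedSymmetryStubSlabProfileOfNonzero
import Summits.NavierStokesRegularity.NavierStokesRegularity.Theorems.SymmetryModuliCountForcedSymmetryRdssLiouvilleTauReduction
import Summits.NavierStokesRegularity.NavierStokesRegularity.Theorems.SymmetryModuliCountForcedSymmetryStubDecayOfSatelliteFree
import Summits.NavierStokesRegularity.NavierStokesRegularity.Theorems.SymmetryModuliCountForcedSymmetryStubSatelliteExclusionTools
import Summits.NavierStokesRegularity.NavierStokesRegularity.Theorems.SymmetryModuliCountForcedSymmetryStubSensitivityNormalization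
import Summits.NavierStokesRegularity.NavierStokesRegularity.Theorems.SymmetryModuliCountForcedSymmetryFastApRemoval
import Summits.NavierStokesRegularity.NavierStokesRegularity.Theorems.SymmetryModuliCountForcedSymmetryStubHullMinimal
import Summits.NavierStokesRegularity.NavierStokesRegularity.Theorems.SymmetryModuliCountForcedSymmetryStubHullSensitive
import Summits.NavierStokesRegularity.NavierStokesRegularity.Theorems.SymmetryModuliCountForcedSymmetryStubHullAlmostPeriodic
import Literature.Analysis.FluidPDE.TypeIAncientMild
import Literature.Analysis.FluidPDE.ClassicalSolution
import Literature.Analysis.FluidPDE.LocalTypeI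
import Literature.Analysis.FluidPDE.LocalTypeILiouville
import Literature.Analysis.FluidPDE.SelfSimilar
import HarnessLib.Audit

/-!
# Skeleton line `closing-dichotomy` for crux `ForcedSymmetry` (stmt-NavierStokesRegularity-4052) — gen c10.2 (lead c10: HULL-CANONICAL reshape of gen c9.4; the three hull stubs LANDED in wave 1 and entered by name)

Route `SymmetryModuliCount`, sub-problem `NavierStokesRegularity`.  Strategist gen s1
(`planner-cstrat-stmt-NavierStokesRegularity-4052-s1-0`, 2026-08-17), reshaped by lead c9 (gen c9.1–c9.4) and by lead c10
(`prover-line-stmt-NavierStokesRegularity-4052-c10-0`, gen c10.1, 2026-08-17).  Line card: `Lines/closing-dichotomy.md`; census: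
`STRATEGY-CENSUS.md` (v3, §D8); lead statuses `STATUS-line-closing-dichotomy-c9.md`, `…-c10.md`; `PICKED.md` (c9, c10).

## gen c10.1 reshape (lead c10) — what changed w.r.t. gen c9.4, and why

gen c9.4 typed the two research residuals POINTWISE at the recurrent singular profile `U` delivered by
`recurrentReduction_proof`: "the scaling orbit of `U` is almost periodic along itself" (`stub_almostPeriodicLiouville`) versus
"`U` is orbit-sensitive at itself on `Q(0,1)`" (`stub_sensitiveLiouville`), the cut being the proved pointwise
Auslander–Yorke half `orbitDichotomy`.  gen c10.1 makes the typing HULL-CANONICAL — a property of the minimal set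
`H(U) = closure {U_{e^σ}}` of the scaling flow in `L³_loc({t ≤ 0} × ℝ³)`, not of the point — by registering the three
known-type theorems of topological dynamics that carry the pointwise data to every hull point, and feeding their output to
the two research stubs as extra hypotheses (so each research stub is IMPLIED by its gen c9.4 form: monotone reshape):

* `stub_hullMinimal` (NEW, known type, S–M): the hull of a uniformly scaling-recurrent field is MINIMAL — every `L³_loc`
  hull point `V` of `U` has `U` in its own hull (Furstenberg 1981, Thm 1.17, in the `L³_loc` model of stmt-1590; the joint
  continuity it needs is the landed strong continuity of the scaling orbit `stub_rlOrbitContinuous` + the exact scaling law).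
* `stub_hullSensitive` (NEW, known type, M): orbit-sensitivity PROPAGATES over a minimal hull with half the constant — if `U`
  is orbit-sensitive at itself with `δ` on `Q(0,1)` and its hull is minimal, every hull point `V` is orbit-sensitive at itself
  with `δ/2` on `Q(0,1)` (the Auslander–Yorke 1980 / Akin–Auslander–Berg 1996 argument "minimal and not equicontinuous ⇒
  sensitive", written out in `L³_loc`: an orbit-equicontinuity neighbourhood of `V` passes to hull points by closure, the dense
  orbit of `U` enters it, and a sensitive pair `(U_{e^{s₀}}, U_{e^{s₀+σ}})` inside it separates by `> δ` — contradiction).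
* `stub_hullAlmostPeriodic` (NEW, known type, S–M): almost periodicity ALONG THE ORBIT is inherited by every hull point with the
  same almost periods (the `sup_s` clause is shift invariant; fixed-time continuity of the scaling flow).
* `stub_sensitiveHullLiouville` (research; replaces `stub_sensitiveLiouville`): hypotheses now say "the hull of `U` is a
  minimal set every point of which is orbit-sensitive at itself with one constant `δ` on `Q(0,1)`" — i.e. `H(U)` is a SENSITIVE
  minimal set of the scaling flow (no equicontinuity point at all), the canonical third case of the trichotomy
  periodic / equicontinuous (Kronecker) / sensitive for compact minimal flows.
* `stub_almostPeriodicHullLiouville` (research; replaces `stub_almostPeriodicLiouville`): hypotheses now say "the hull of `U`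
  is minimal and every hull point is almost periodic along its orbit" — `H(U)` is an EQUICONTINUOUS (Kronecker) minimal set
  that is not a closed orbit (¬ RDSS at `U`).
* `stub_satelliteExclusion`, `stub_centredWall`: byte-identical (stubs 1 and 3 of crux stmt-8561's line `birth`).

Composition (`typeIAncientLiouville_of_line`, sorry-free modulo the stubs; `ForcedSymmetry_of` concludes the crux BY NAME):
bridge (p139433) → `recurrentReduction_proof` (stmt-1590) → periodic case to 8561 (`classicalRepresentative_of_rdssProfile` +
`rdssLiouvilleInClass_of_birth`) → `orbitDichotomy` (proved, c9) → a.p. branch: `stub_hullMinimal` + `stub_hullAlmostPeriodic`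
feed `stub_almostPeriodicHullLiouville`; sensitive branch: `stub_sensitivityNormalization` (landed p152690) + `stub_hullMinimal`
+ `stub_hullSensitive` feed `stub_sensitiveHullLiouville`.  Registered stubs gen c10.1 (sorries = 7): hullMinimal,
hullSensitive, hullAlmostPeriodic (known type — ALL THREE LANDED in wave 1 of c10: p158041, p159198, p158194; entered by name in
gen c10.2, sorries = 4), sensitiveHullLiouville, almostPeriodicHullLiouville (research walls, unchanged in content: "no sensitive /
no quasi-periodic Type-I singularity model"), satelliteExclusion, centredWall (8561's).  NO-SLACK certificate of the hull-canonical
split: `forcedSymmetry_iff_hullLiouvilleParts : ForcedSymmetry ↔ (SensitiveHullLiouville ∧ AlmostPeriodicHullLiouville ∧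
RDSSLiouvilleInClass)` with the parts = the two research stubs below verbatim + stmt-8561
(`Theorems/SymmetryModuliCountForcedSymmetryHullLiouvilleParts.lean`, p160070, lead c10); abstract Auslander–Yorke dichotomy for group
actions on uniform spaces: `Literature/Dynamics/TopologicalDynamics/SensitiveOrEquicontinuous.lean` (p160345).

Honest standing (unchanged since census v3 and leads c7–c9): the crux ⇔ X = `TypeIAncientLiouville`
(`forcedSymmetry_iff_typeIAncientLiouville`) ⇔ crux stmt-1589 (`typeIAncientLiouville_iff_recurrentLiouville`); the four
research/8561 stubs are open in print; `forcedSymmetry_iff_liouvilleParts` (p155499) certifies no slack.  gen c10.1 lands the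
topological-dynamics package of the hull (minimality, sensitivity propagation, a.p. inheritance) and re-types the walls by the
isomorphism class of the minimal hull; it does not move a wall.

## History (gen s1 → c9.4), kept short

gen s1 (strategist): `stub_closingDichotomy` (accumulated ∨ a.p.) + `stub_almostPeriodicLiouville` + 8561's 3a/3c.  gen c9.1–c9.4
(lead c9): periodic case split off by pure logic; `orbitDichotomy` PROVED (pointwise Auslander–Yorke half);
`stub_sensitivityNormalization` LANDED (p152690); accumulation form shown vacuous given 8561 (`sensitiveClosing_iff_sensitiveLiouville`,
p155499) hence the Liouville form `stub_sensitiveLiouville`; support files p152255 `…FastApRemoval`, p153609 `…ClosingDichotomyGlue`,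
p154722 `…ApWindowRdss`, p155228 `…ClosingDichotomySplit`, p155499 `…SensitiveClosingShape`.  c9's no-go remark (Poláčik realisation:
dissipative-semiflow axioms alone cannot prove the sensitive stub) and its independence worlds W1'/W2/W3 carry over verbatim.

## Disproof used

`Cruxes/ForcedSymmetry/Disproof.lean` v9 (unchanged since 2026-08-16T06:11Z; re-read by c10): `forcedSymmetry_false_without_H3` /
`not_forcedSymmetryOnDriftClass` honoured — the research stubs quantify over genuine Navier–Stokes classes (suitable weak + `𝐈 < ⊤` +
rate); the three hull stubs are pure `L³_loc` dynamics with no Navier–Stokes content and claim nothing about the class; §10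
(`dss_does_not_force_symmetry`): the (R)DSS stratum goes to a LIOUVILLE statement (8561), not to a symmetry; §5 small-`C` corner
consistent.  `-- Targets` of v9 concern the dead line `time-anchor-bootstrap` only.  Negatives index: no stub is an instance.
-/

noncomputable section

set_option linter.dupNamespace false

open MeasureTheory Set Filter Topology Function

namespace Summit.NavierStokesRegularity.NavierStokesRegularity.Cruxes.ForcedSymmetry.ClosingDichotomy

open Literature.Analysis.FluidPDE Metric
open scoped ENNReal

local notation "ℝ³" => EuclideanSpace ℝ (Fin 3)

/-! ## The registered stubs (gen c10.1: seven) -/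

/-! ### Known-type hull stubs (topological dynamics of the scaling flow in `L³_loc`; no Navier–Stokes content) -/

/-- **Stub H1 — `stub_hullMinimal` — LANDED (p158041, gen c10.1 wave 1; the tree theorem `Theorems.stub_hullMinimal`): the hull of a uniformly scaling-recurrent field is a
MINIMAL set.**  Clauses: a field `W : ℝ → ℝ³ → ℝ³` "lies in `L³_loc`" if `W ∈ L³(Q(0,R))` for every `R > 0`; `V` is a HULL
POINT of `U` if for every `ε > 0` and compact `K ⊆ {t ≤ 0} × ℝ³` some orbit point `U_{e^τ} = nsRescale (exp τ) U` is within
`ε` of `V` in `L³(K)`.  Statement: if `U, V ∈ L³_loc`, `U` is uniformly recurrent under the scaling flow (VERBATIM the clause of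
`RecurrentProfiles.RecurrentLiouville` / `IsScalingUniformlyRecurrent`) and `V` is a hull point of `U`, then `U` is a hull point
of `V`.  Proof route (all tools in tree): model `X = {W | ∀ n, W ∈ L³(Q(0,n+1))}` with the initial topology of the maps into the
Banach spaces `L³(Q(0,n+1))` exactly as in `recurrentReduction_proof` (pseudo-metrisable ⇒ regular); the scaling flow
`ϕ σ W = W_{e^σ}` acts with the action law `nsScalingFlow_add`; it is JOINTLY continuous on `ℝ × X` (separate continuity in `W`
with a locally uniform Lipschitz constant by the exact scaling law `eLpNorm_zoom_sub_zoom` / `eLpNorm_nsRescale_restrict`, plus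
strong continuity in `σ` = the landed `stub_rlOrbitContinuous`, moved from `c = 1` to any `c₀` by the group law); uniform
recurrence of the point from the field clause (`IsScalingUniformlyRecurrent.isUniformlyRecurrentPt`, the `L³(K)`-balls are a
neighbourhood base by `exists_eLpNorm_restrict_le_of_isCompact`); then Furstenberg's Thm 1.17
`Literature.Dynamics.TopologicalDynamics.mem_closure_orbit_of_isUniformlyRecurrentPt`; read back through the same dictionary.
[cite: Furstenberg1981, Ch. 1 §4, Thm. 1.17; Auslander1988, Ch. 1 Thm. 7] -/
theorem stub_hullMinimal :
    ∀ (U V : ℝ → ℝ³ → ℝ³),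
      (∀ R : ℝ, 0 < R → MemLp (uncurry U) 3 (volume.restrict (parabolicCylinder R (0 : ℝ × ℝ³)))) →
      (∀ R : ℝ, 0 < R → MemLp (uncurry V) 3 (volume.restrict (parabolicCylinder R (0 : ℝ × ℝ³)))) →
      (∀ ε : ℝ, 0 < ε → ∀ K : Set (ℝ × ℝ³), IsCompact K → K ⊆ Set.Iic (0 : ℝ) ×ˢ Set.univ →
        ∃ L : ℝ, 0 < L ∧ ∀ a : ℝ, ∃ σ ∈ Set.Icc a (a + L),
          eLpNorm (fun z : ℝ × ℝ³ => nsRescale (Real.exp σ) U z.1 z.2 - U z.1 z.2) 3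
            (volume.restrict K) ≤ ENNReal.ofReal ε) →
      (∀ ε : ℝ, 0 < ε → ∀ K : Set (ℝ × ℝ³), IsCompact K → K ⊆ Set.Iic (0 : ℝ) ×ˢ Set.univ →
        ∃ τ : ℝ, eLpNorm (fun z : ℝ × ℝ³ => nsRescale (Real.exp τ) U z.1 z.2 - V z.1 z.2) 3
          (volume.restrict K) ≤ ENNReal.ofReal ε) →
      ∀ ε : ℝ, 0 < ε → ∀ K : Set (ℝ × ℝ³), IsCompact K → K ⊆ Set.Iic (0 : ℝ) ×ˢ Set.univ →
        ∃ τ : ℝ, eLpNorm (fun z : ℝ × ℝ³ => nsRescale (Real.exp τ) V z.1 z.2 - U z.1 z.2) 3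
          (volume.restrict K) ≤ ENNReal.ofReal ε :=
  Summit.NavierStokesRegularity.NavierStokesRegularity.Theorems.stub_hullMinimal

/-- **Stub H2 — `stub_hullSensitive` — LANDED (p159198, gen c10.1 wave 1; the tree theorem `Theorems.stub_hullSensitive`): orbit-sensitivity propagates over a minimal hull**
(Auslander–Yorke 1980 / Akin–Auslander–Berg 1996, "a minimal system with a non-equicontinuity point is sensitive", written out in
`L³_loc`).  Hypotheses: `U ∈ L³_loc`; the hull of `U` is minimal (the conclusion of `stub_hullMinimal`, taken as a hypothesis so
that the two stubs are independent); `U` is ORBIT-SENSITIVE AT ITSELF with constant `δ > 0` on `Q(0,1)` (every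
`L³_loc`-neighbourhood of `U` contains an orbit point `U_{e^σ}` whose orbit separates from `U`'s by more than `δ` in `L³(Q(0,1))`
at some log-time `s` — the output of the landed `stub_sensitivityNormalization`).  Conclusion: every hull point `V ∈ L³_loc` of
`U` is orbit-sensitive at itself with constant `δ/2` on `Q(0,1)`.  Proof sketch: if not, there are `ε₀, K₀` with
`‖V_{e^σ} − V‖_{L³(K₀)} ≤ ε₀ ⇒ ∀ s, ‖(V_{e^s})_{e^σ} − V_{e^s}‖_{L³(Q₁)} ≤ δ/2`; by fixed-time continuity of the flow (exact scaling
law) this passes to hull points: every `W = U_{e^c}` with `‖W − V‖_{L³(K₀)} ≤ ε₀/2` (a hull point of `V` by minimality) satisfies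
`∀ r, ‖W_{e^r} − V_{e^r}‖_{L³(Q₁)} ≤ δ/2`.  Pick `s₀` with `‖U_{e^{s₀}} − V‖_{L³(K₀)} ≤ ε₀/4` (hull), then by sensitivity of `U` on the
dilated compact set `Φ_{e^{s₀}} K₀` (`eLpNorm_nsRescale_restrict`, `image_stAffine_sq_subset_Iic_prod_univ`) a pair `σ, s` with
`‖U_{e^{s₀+σ}} − U_{e^{s₀}}‖_{L³(K₀)} ≤ ε₀/4` and `‖U_{e^{σ+s}} − U_{e^s}‖_{L³(Q₁)} > δ`; both `U_{e^{s₀}}`, `U_{e^{s₀+σ}}` are within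
`ε₀/2` of `V` on `K₀`, so at `r = s − s₀` their orbits are each within `δ/2` of `V_{e^r}`, hence within `δ` of each other
(`nsScalingFlow_add`) — contradiction.  No Navier–Stokes input, no compactness.
[cite: AuslanderYorke1980 (Tôhoku Math. J. 32, 177–188, doi:10.2748/tmj/1178229634), Thm. 1 and Cor.; AkinAuslanderBerg1996, Thm. 2.4–2.5; Glasner2003, Thm. 1.41] -/
theorem stub_hullSensitive :
    ∀ (U : ℝ → ℝ³ → ℝ³) (δ : ℝ), 0 < δ →
      (∀ R : ℝ, 0 < R → MemLp (uncurry U) 3 (volume.restrict (parabolicCylinder R (0 : ℝ × ℝ³)))) →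
      (∀ V : ℝ → ℝ³ → ℝ³,
        (∀ R : ℝ, 0 < R → MemLp (uncurry V) 3 (volume.restrict (parabolicCylinder R (0 : ℝ × ℝ³)))) →
        (∀ ε : ℝ, 0 < ε → ∀ K : Set (ℝ × ℝ³), IsCompact K → K ⊆ Set.Iic (0 : ℝ) ×ˢ Set.univ →
          ∃ τ : ℝ, eLpNorm (fun z : ℝ × ℝ³ => nsRescale (Real.exp τ) U z.1 z.2 - V z.1 z.2) 3
            (volume.restrict K) ≤ ENNReal.ofReal ε) →
        ∀ ε : ℝ, 0 < ε → ∀ K : Set (ℝ × ℝ³), IsCompact K → K ⊆ Set.Iic (0 : ℝ) ×ˢ Set.univ →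
          ∃ τ : ℝ, eLpNorm (fun z : ℝ × ℝ³ => nsRescale (Real.exp τ) V z.1 z.2 - U z.1 z.2) 3
            (volume.restrict K) ≤ ENNReal.ofReal ε) →
      (∀ ε : ℝ, 0 < ε → ∀ K : Set (ℝ × ℝ³), IsCompact K → K ⊆ Set.Iic (0 : ℝ) ×ˢ Set.univ →
        ∃ σ : ℝ, eLpNorm (fun z : ℝ × ℝ³ => nsRescale (Real.exp σ) U z.1 z.2 - U z.1 z.2) 3
            (volume.restrict K) ≤ ENNReal.ofReal ε ∧
          ∃ s : ℝ, ENNReal.ofReal δ < eLpNorm (fun z : ℝ × ℝ³ =>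
              nsRescale (Real.exp σ) (nsRescale (Real.exp s) U) z.1 z.2 - nsRescale (Real.exp s) U z.1 z.2) 3
            (volume.restrict (parabolicCylinder 1 (0 : ℝ × ℝ³)))) →
      ∀ V : ℝ → ℝ³ → ℝ³,
        (∀ R : ℝ, 0 < R → MemLp (uncurry V) 3 (volume.restrict (parabolicCylinder R (0 : ℝ × ℝ³)))) →
        (∀ ε : ℝ, 0 < ε → ∀ K : Set (ℝ × ℝ³), IsCompact K → K ⊆ Set.Iic (0 : ℝ) ×ˢ Set.univ →
          ∃ τ : ℝ, eLpNorm (fun z : ℝ × ℝ³ => nsRescale (Real.exp τ) U z.1 z.2 - V z.1 z.2) 3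
            (volume.restrict K) ≤ ENNReal.ofReal ε) →
        ∀ ε : ℝ, 0 < ε → ∀ K : Set (ℝ × ℝ³), IsCompact K → K ⊆ Set.Iic (0 : ℝ) ×ˢ Set.univ →
          ∃ σ : ℝ, eLpNorm (fun z : ℝ × ℝ³ => nsRescale (Real.exp σ) V z.1 z.2 - V z.1 z.2) 3
              (volume.restrict K) ≤ ENNReal.ofReal ε ∧
            ∃ s : ℝ, ENNReal.ofReal (δ / 2) < eLpNorm (fun z : ℝ × ℝ³ =>
                nsRescale (Real.exp σ) (nsRescale (Real.exp s) V) z.1 z.2 - nsRescale (Real.exp s) V z.1 z.2) 3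
              (volume.restrict (parabolicCylinder 1 (0 : ℝ × ℝ³))) :=
  Summit.NavierStokesRegularity.NavierStokesRegularity.Theorems.stub_hullSensitive

/-- **Stub H3 — `stub_hullAlmostPeriodic` — LANDED (p158194, gen c10.1 wave 1; the tree theorem `Theorems.stub_hullAlmostPeriodic`): almost periodicity along the orbit is inherited by
hull points.**  If `U, V ∈ L³_loc`, the scaling orbit of `U` is almost periodic ALONG ITSELF (for every `ε`, compact `K`:
relatively dense log-scales `σ` with `sup_s ‖(U_{e^s})_{e^σ} − U_{e^s}‖_{L³(K)} ≤ ε` — the first disjunct of `orbitDichotomy`) and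
`V` is a hull point of `U`, then the orbit of `V` is almost periodic along itself (with the same almost periods).  Proof sketch:
fix `ε, K`, take `L` and, for a window `[a, a+L]`, the almost period `σ` of `U`; for any `s` and `η > 0` choose `τ` with
`U_{e^τ}` close to `V` on the compact set `Φ_{e^s} K ∪ Φ_{e^{σ+s}} K` (hull; exact scaling law `eLpNorm_nsRescale_restrict` for
the FIXED times `s`, `σ + s`); then `‖(V_{e^s})_{e^σ} − V_{e^s}‖_{L³(K)} ≤ η + ‖U_{e^{σ+s+τ}} − U_{e^{s+τ}}‖_{L³(K)} + η ≤ ε + 2η`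
(the `sup_s` clause of `U` at `s + τ`; `nsScalingFlow_add`), and `η → 0` (`ENNReal.le_of_forall_pos_le_add`).  No
Navier–Stokes input, no minimality, no compactness. [cite: Furstenberg1981, Ch. 1 §4; Fink1974 (LNM 377), Ch. 1 (hulls of a.p. functions)] -/
theorem stub_hullAlmostPeriodic :
    ∀ (U V : ℝ → ℝ³ → ℝ³),
      (∀ R : ℝ, 0 < R → MemLp (uncurry U) 3 (volume.restrict (parabolicCylinder R (0 : ℝ × ℝ³)))) →
      (∀ R : ℝ, 0 < R → MemLp (uncurry V) 3 (volume.restrict (parabolicCylinder R (0 : ℝ × ℝ³)))) →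
      (∀ ε : ℝ, 0 < ε → ∀ K : Set (ℝ × ℝ³), IsCompact K → K ⊆ Set.Iic (0 : ℝ) ×ˢ Set.univ →
        ∃ L : ℝ, 0 < L ∧ ∀ a : ℝ, ∃ σ ∈ Set.Icc a (a + L), ∀ s : ℝ,
          eLpNorm (fun z : ℝ × ℝ³ =>
              nsRescale (Real.exp σ) (nsRescale (Real.exp s) U) z.1 z.2 - nsRescale (Real.exp s) U z.1 z.2) 3
            (volume.restrict K) ≤ ENNReal.ofReal ε) →
      (∀ ε : ℝ, 0 < ε → ∀ K : Set (ℝ × ℝ³), IsCompact K → K ⊆ Set.Iic (0 : ℝ) ×ˢ Set.univ →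
        ∃ τ : ℝ, eLpNorm (fun z : ℝ × ℝ³ => nsRescale (Real.exp τ) U z.1 z.2 - V z.1 z.2) 3
          (volume.restrict K) ≤ ENNReal.ofReal ε) →
      ∀ ε : ℝ, 0 < ε → ∀ K : Set (ℝ × ℝ³), IsCompact K → K ⊆ Set.Iic (0 : ℝ) ×ˢ Set.univ →
        ∃ L : ℝ, 0 < L ∧ ∀ a : ℝ, ∃ σ ∈ Set.Icc a (a + L), ∀ s : ℝ,
          eLpNorm (fun z : ℝ × ℝ³ =>
              nsRescale (Real.exp σ) (nsRescale (Real.exp s) V) z.1 z.2 - nsRescale (Real.exp s) V z.1 z.2) 3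
            (volume.restrict K) ≤ ENNReal.ofReal ε :=
  Summit.NavierStokesRegularity.NavierStokesRegularity.Theorems.stub_hullAlmostPeriodic

/-! ### Landed known-type stub of gen c9.1 (entered by name) -/

/-- **Stub 1a — `stub_sensitivityNormalization` — LANDED (p152690, gen c9.1 wave 1): the tree theorem
`Theorems.stub_sensitivityNormalization`; the sensitivity constant may be measured on `Q(0,1)`.**  If a field `u` is orbit-sensitive at itself with constant `δ` on SOME compact
`K₁ ⊆ {t ≤ 0} × ℝ³` (for every `ε > 0` and compact `K` there is an orbit point `u_{e^σ}` within `ε` of `u` in `L³(K)` and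
a log-time `s` with `‖(u_{e^s})_{e^σ} − u_{e^s}‖_{L³(K₁)} > δ`), then it is orbit-sensitive with some constant `δ' > 0` on
the unit backward cylinder `Q(0,1)`.  Proof sketch: `K₁ ⊆ Q(0, r) ∪ ({0} × ℝ³)` for some `r = n + 1`
(`exists_eLpNorm_restrict_le_of_isCompact`), and the exact scaling law
`‖F‖_{L³(Q(0,r))} = r^{2/3} ‖F_r‖_{L³(Q(0,1))}` (`eLpNorm_zoom_sub_zoom` with `nsRescale_eq_zoom`, `nsRescale_mul`,
`Real.exp_add`) turns a separation `> δ` on `Q(0,r)` at log-time `s` into a separation `> δ r^{-2/3}` on `Q(0,1)` at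
log-time `s + log r`; take `δ' = δ · (r (r⁵)^{-1/3})`-corrected accordingly.  No Navier–Stokes input. [folklore] -/
theorem stub_sensitivityNormalization :
    ∀ (u : ℝ → ℝ³ → ℝ³),
      (∃ δ : ℝ, 0 < δ ∧ ∃ K₁ : Set (ℝ × ℝ³), IsCompact K₁ ∧ K₁ ⊆ Set.Iic (0 : ℝ) ×ˢ Set.univ ∧
        ∀ ε : ℝ, 0 < ε → ∀ K : Set (ℝ × ℝ³), IsCompact K → K ⊆ Set.Iic (0 : ℝ) ×ˢ Set.univ →
          ∃ σ : ℝ, eLpNorm (fun z : ℝ × ℝ³ => nsRescale (Real.exp σ) u z.1 z.2 - u z.1 z.2) 3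
              (volume.restrict K) ≤ ENNReal.ofReal ε ∧
            ∃ s : ℝ, ENNReal.ofReal δ < eLpNorm (fun z : ℝ × ℝ³ =>
                nsRescale (Real.exp σ) (nsRescale (Real.exp s) u) z.1 z.2 - nsRescale (Real.exp s) u z.1 z.2) 3
              (volume.restrict K₁)) →
      ∃ δ : ℝ, 0 < δ ∧
        ∀ ε : ℝ, 0 < ε → ∀ K : Set (ℝ × ℝ³), IsCompact K → K ⊆ Set.Iic (0 : ℝ) ×ˢ Set.univ →
          ∃ σ : ℝ, eLpNorm (fun z : ℝ × ℝ³ => nsRescale (Real.exp σ) u z.1 z.2 - u z.1 z.2) 3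
              (volume.restrict K) ≤ ENNReal.ofReal ε ∧
            ∃ s : ℝ, ENNReal.ofReal δ < eLpNorm (fun z : ℝ × ℝ³ =>
                nsRescale (Real.exp σ) (nsRescale (Real.exp s) u) z.1 z.2 - nsRescale (Real.exp s) u z.1 z.2) 3
              (volume.restrict (parabolicCylinder 1 (0 : ℝ × ℝ³))) :=
  Summit.NavierStokesRegularity.NavierStokesRegularity.Theorems.stub_sensitivityNormalization

/-! ### Research stubs (the two walls of this line, hull-canonical typing) -/

/-- **Stub 1 — `stub_sensitiveHullLiouville` (research; gen c10.1 hull-canonical form of gen c9.4's `stub_sensitiveLiouville`: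
"no SENSITIVE minimal Type-I hull").**  Hypotheses: a profile `(u,p,G)` of Albritton–Barker's slab class `𝒦_C` (suitable weak on
`ℝ³ × (−∞,0)`, weak gradient, `𝐈 < ∞`, rate `‖u(t,x)‖ ≤ C/√(−t)`), uniformly recurrent under the scaling flow `σ ↦ u_{e^σ}` in
`L³_loc({t ≤ 0} × ℝ³)` (VERBATIM the clause of `RecurrentProfiles.RecurrentLiouville`), NOT rotated-discretely self-similar in
stmt-8561's sense, and whose HULL IS A SENSITIVE MINIMAL SET: for some `δ > 0`, every `L³_loc` hull point `V` of `u`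
(`V ∈ L³(Q(0,R))` for all `R`, approximated in every `L³(K)` by orbit points `u_{e^τ}`) has `u` in its own hull (minimality) and is
orbit-sensitive at itself with constant `δ` on `Q(0,1)`.  (With `V = u` this contains gen c9.4's pointwise hypothesis, so this
stub is implied by `stub_sensitiveLiouville`; conversely the composition derives the hull clause from the pointwise one by
`stub_hullMinimal` + `stub_hullSensitive`.)  Conclusion: `u` is regular at the origin.  In words: no compact minimal set of the
Navier–Stokes scaling flow inside the singular Type-I class is SENSITIVE (equivalently, by Auslander–Yorke, fails to be
equicontinuous) unless it is excluded otherwise — the third Liouville theorem next to `stub_almostPeriodicHullLiouville`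
(equicontinuous non-periodic hulls) and stmt-8561 (closed orbits); pairwise disjoint single-object refutation witnesses; jointly the
crux (`forcedSymmetry_iff_liouvilleParts`, p155499; the hull clauses are discharged by known-type theorems, so no slack is added).
Why plausibly true / why it might fail / no-go remark: verbatim from gen c9.4 (card `Lines/closing-dichotomy.md`, status c9):
intended engines are closing lemmas for hyperbolic measures of C² Hilbert/Banach semiflows (Katok / Lian–Young / Ma) whose periodic
orbits = origin-centred RDSS profiles are killed by 8561, or any NS-specific exclusion of sensitive Type-I hulls; the enemy is ONE
sensitive aperiodic minimal Type-I hull carrying no hyperbolic measure (horocycle-like); by Poláčik's realisation theorems the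
abstract form over dissipative semiflows is false, so a proof must use Navier–Stokes structure (ESS backward uniqueness =
injectivity, A–B compactness, Tsai = no rest point, Killing-leaf Liouvilles).
[cite: AuslanderYorke1980, Thm. 1; Katok1980 (IHES 51) §§3–4; LianYoung2012 (JAMS 25); Ma2022; Polacik1992; Polacik1995; DancerPolacik1999; BradshawTsai2017CPDE OP 5.1] -/
theorem stub_sensitiveHullLiouville :
    ∀ (u : ℝ → ℝ³ → ℝ³) (p : ℝ → ℝ³ → ℝ) (G : ℝ → ℝ³ → ℝ³ →L[ℝ] ℝ³) (C : ℝ),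
      IsSuitableWeakSolutionOn (slab ℝ³ (Set.Iio 0) isOpen_Iio) 1 0 u p →
      HasWeakSpatialGradientOn (slab ℝ³ (Set.Iio 0) isOpen_Iio) u G →
      typeIBound (Set.Iio (0 : ℝ) ×ˢ Set.univ) u p G < ⊤ →
      HasTypeITimeDecay C u →
      (∀ ε : ℝ, 0 < ε → ∀ K : Set (ℝ × ℝ³), IsCompact K → K ⊆ Set.Iic (0 : ℝ) ×ˢ Set.univ →
        ∃ L : ℝ, 0 < L ∧ ∀ a : ℝ, ∃ σ ∈ Set.Icc a (a + L),
          eLpNorm (fun z : ℝ × ℝ³ => nsRescale (Real.exp σ) u z.1 z.2 - u z.1 z.2) 3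
            (volume.restrict K) ≤ ENNReal.ofReal ε) →
      (¬ ∃ l : ℝ, 1 < l ∧ ∃ (R : ℝ³ ≃ₗᵢ[ℝ] ℝ³) (ξ : ℝ³) (τ : ℝ), τ ≤ 0 ∧
          (fun z : ℝ × ℝ³ => l • R.symm (u (l ^ 2 * z.1 + τ) (l • R z.2 + ξ)))
            =ᵐ[volume.restrict (Set.Iio (0 : ℝ) ×ˢ Set.univ)] (fun z : ℝ × ℝ³ => u z.1 z.2)) →
      (∃ δ : ℝ, 0 < δ ∧ ∀ V : ℝ → ℝ³ → ℝ³,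
        (∀ R : ℝ, 0 < R → MemLp (uncurry V) 3 (volume.restrict (parabolicCylinder R (0 : ℝ × ℝ³)))) →
        (∀ ε : ℝ, 0 < ε → ∀ K : Set (ℝ × ℝ³), IsCompact K → K ⊆ Set.Iic (0 : ℝ) ×ˢ Set.univ →
          ∃ τ : ℝ, eLpNorm (fun z : ℝ × ℝ³ => nsRescale (Real.exp τ) u z.1 z.2 - V z.1 z.2) 3
            (volume.restrict K) ≤ ENNReal.ofReal ε) →
        (∀ ε : ℝ, 0 < ε → ∀ K : Set (ℝ × ℝ³), IsCompact K → K ⊆ Set.Iic (0 : ℝ) ×ˢ Set.univ →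
          ∃ τ : ℝ, eLpNorm (fun z : ℝ × ℝ³ => nsRescale (Real.exp τ) V z.1 z.2 - u z.1 z.2) 3
            (volume.restrict K) ≤ ENNReal.ofReal ε) ∧
        (∀ ε : ℝ, 0 < ε → ∀ K : Set (ℝ × ℝ³), IsCompact K → K ⊆ Set.Iic (0 : ℝ) ×ˢ Set.univ →
          ∃ σ : ℝ, eLpNorm (fun z : ℝ × ℝ³ => nsRescale (Real.exp σ) V z.1 z.2 - V z.1 z.2) 3
              (volume.restrict K) ≤ ENNReal.ofReal ε ∧
            ∃ s : ℝ, ENNReal.ofReal δ < eLpNorm (fun z : ℝ × ℝ³ =>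
                nsRescale (Real.exp σ) (nsRescale (Real.exp s) V) z.1 z.2 - nsRescale (Real.exp s) V z.1 z.2) 3
              (volume.restrict (parabolicCylinder 1 (0 : ℝ × ℝ³))))) →
      ¬ IsBackwardSingularPoint u 0 := by
  sorry

/-- **Stub 2 — `stub_almostPeriodicHullLiouville` (research, named-wall type; gen c10.1 hull-canonical form of
`stub_almostPeriodicLiouville`: "no EQUICONTINUOUS non-periodic minimal Type-I hull" = no quasi-periodically / limit-periodically
self-similar Type-I blow-up).**  A profile `(u,p,G)` of `𝒦_C` whose scaling orbit is Bohr-almost-periodic ALONG ITSELF in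
`L³_loc`, which is NOT rotated-discretely self-similar in the sense of stmt-8561, and whose hull is minimal with every hull point
again almost periodic along its orbit (the hull clause; discharged in the composition by `stub_hullMinimal` +
`stub_hullAlmostPeriodic`, so this stub is implied by gen c9.4's `stub_almostPeriodicLiouville`), is regular at the origin.  The
EXCLUDED periodic case is exactly stmt-8561, so the refutation witness is a genuinely quasi-periodic (frequency module of rank ≥ 2 in
log-scale) or limit-periodic singular Type-I profile, i.e. an equicontinuous minimal hull of the scaling flow that is not a closed
orbit.  Why plausibly true / why it might fail: verbatim from gen c9.4 — Bohr–Fourier expansion in log-scale with complex-homogeneous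
coefficient profiles coupled through the Bradshaw–Tsai hierarchy; FAST almost periodicity removed (`fastApRemoval_box`, p152255);
portrait of the enemy: SLOW (`apSlow_of_singular`) with ESCAPING almost periods (`rdss_of_almostPeriodsInWindow`, p154722); the open
regime is slow almost periodicity exactly as `l ≥ λ_*` is open for DSS (BT OP 5.1 one frequency up).
[cite: BradshawTsai2017CPDE OP 5.1 and §3; ChaeWolf2017RemovingDSS Thm 1.3; PineauVicol2026 Thm 1.4, Conj. 1.1; Fink1974 (LNM 377) Ch. 1–2; Furstenberg1981 Ch. 1 §4] -/
theorem stub_almostPeriodicHullLiouville :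
    ∀ (u : ℝ → ℝ³ → ℝ³) (p : ℝ → ℝ³ → ℝ) (G : ℝ → ℝ³ → ℝ³ →L[ℝ] ℝ³) (C : ℝ),
      IsSuitableWeakSolutionOn (slab ℝ³ (Set.Iio 0) isOpen_Iio) 1 0 u p →
      HasWeakSpatialGradientOn (slab ℝ³ (Set.Iio 0) isOpen_Iio) u G →
      typeIBound (Set.Iio (0 : ℝ) ×ˢ Set.univ) u p G < ⊤ →
      HasTypeITimeDecay C u →
      (∀ ε : ℝ, 0 < ε → ∀ K : Set (ℝ × ℝ³), IsCompact K → K ⊆ Set.Iic (0 : ℝ) ×ˢ Set.univ →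
        ∃ L : ℝ, 0 < L ∧ ∀ a : ℝ, ∃ σ ∈ Set.Icc a (a + L), ∀ s : ℝ,
          eLpNorm (fun z : ℝ × ℝ³ =>
              nsRescale (Real.exp σ) (nsRescale (Real.exp s) u) z.1 z.2 - nsRescale (Real.exp s) u z.1 z.2) 3
            (volume.restrict K) ≤ ENNReal.ofReal ε) →
      (¬ ∃ l : ℝ, 1 < l ∧ ∃ (R : ℝ³ ≃ₗᵢ[ℝ] ℝ³) (ξ : ℝ³) (τ : ℝ), τ ≤ 0 ∧
          (fun z : ℝ × ℝ³ => l • R.symm (u (l ^ 2 * z.1 + τ) (l • R z.2 + ξ)))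
            =ᵐ[volume.restrict (Set.Iio (0 : ℝ) ×ˢ Set.univ)] (fun z : ℝ × ℝ³ => u z.1 z.2)) →
      (∀ V : ℝ → ℝ³ → ℝ³,
        (∀ R : ℝ, 0 < R → MemLp (uncurry V) 3 (volume.restrict (parabolicCylinder R (0 : ℝ × ℝ³)))) →
        (∀ ε : ℝ, 0 < ε → ∀ K : Set (ℝ × ℝ³), IsCompact K → K ⊆ Set.Iic (0 : ℝ) ×ˢ Set.univ →
          ∃ τ : ℝ, eLpNorm (fun z : ℝ × ℝ³ => nsRescale (Real.exp τ) u z.1 z.2 - V z.1 z.2) 3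
            (volume.restrict K) ≤ ENNReal.ofReal ε) →
        (∀ ε : ℝ, 0 < ε → ∀ K : Set (ℝ × ℝ³), IsCompact K → K ⊆ Set.Iic (0 : ℝ) ×ˢ Set.univ →
          ∃ τ : ℝ, eLpNorm (fun z : ℝ × ℝ³ => nsRescale (Real.exp τ) V z.1 z.2 - u z.1 z.2) 3
            (volume.restrict K) ≤ ENNReal.ofReal ε) ∧
        (∀ ε : ℝ, 0 < ε → ∀ K : Set (ℝ × ℝ³), IsCompact K → K ⊆ Set.Iic (0 : ℝ) ×ˢ Set.univ →
          ∃ L : ℝ, 0 < L ∧ ∀ a : ℝ, ∃ σ ∈ Set.Icc a (a + L), ∀ s : ℝ,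
            eLpNorm (fun z : ℝ × ℝ³ =>
                nsRescale (Real.exp σ) (nsRescale (Real.exp s) V) z.1 z.2 - nsRescale (Real.exp s) V z.1 z.2) 3
              (volume.restrict K) ≤ ENNReal.ofReal ε)) →
      ¬ IsBackwardSingularPoint u 0 := by
  sorry

/-! ### Crux stmt-8561's birth stubs (shared verbatim) -/

/-- **Stub 3a — `stub_satelliteExclusion` (VERBATIM the registered stub 1 of crux stmt-8561's line `birth` = stub 3a of
the live line `recurrent-closing`; L; OPEN LEMMA, gap (iii) of the printed rungs).** For every smooth profile `(w, q, H)` of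
`𝒦_C` invariant a.e. on the slab under `(t,x) ↦ l • R⁻¹ w (l²t) (l R x + ξ)`, `l > 1` (centre on the final slice), every
final-slice point `(0, y)` other than the spatial centre is NOT a backward singular point.  Model: Chae–Wolf 2017 Thm 1.1.
Why it might fail: a Type-I RDSS profile with a singular satellite orbit (lead c6/c7: ⇔ `∫∫_{(−l²,−1]×ℝ³} ‖w‖⁴ < ∞`;
the discrete factor is the open core — "a Type-I singularity riding on an RDSS background").
[cite: ChaeWolf2017RemovingDSS, Thm 1.1; AlbrittonBarker2019, §1] -/
theorem stub_satelliteExclusion :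
    ∀ (w : ℝ → ℝ³ → ℝ³) (q : ℝ → ℝ³ → ℝ) (H : ℝ → ℝ³ → ℝ³ →L[ℝ] ℝ³) (C : ℝ),
      IsSuitableWeakSolutionOn (slab ℝ³ (Set.Iio 0) isOpen_Iio) 1 0 w q →
      HasWeakSpatialGradientOn (slab ℝ³ (Set.Iio 0) isOpen_Iio) w H →
      typeIBound (Set.Iio (0 : ℝ) ×ˢ Set.univ) w q H < ⊤ →
      HasTypeITimeDecay C w →
      IsClassicalNSSolutionOn (Set.Iio 0) 1 0 w q →
      ∀ (l : ℝ) (R : ℝ³ ≃ₗᵢ[ℝ] ℝ³) (ξ : ℝ³), 1 < l →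
        (fun z : ℝ × ℝ³ => l • R.symm (w (l ^ 2 * z.1) (l • R z.2 + ξ)))
          =ᵐ[volume.restrict (Set.Iio (0 : ℝ) ×ˢ Set.univ)] (fun z : ℝ × ℝ³ => w z.1 z.2) →
        ∀ y : ℝ³, y ≠ l • R y + ξ → ¬ IsBackwardSingularPoint w ((0 : ℝ), y) := by
  sorry

/-- **Stub 3b — `stub_decayOfSatelliteFree` — LANDED (p142689):** the tree theorem
`Theorems.SymmetryModuliCountForcedSymmetry.stub_decayOfSatelliteFree` (Chae–Wolf's scaling step, no Navier–Stokes input).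
[cite: ChaeWolf2017RemovingDSS, proof of Thm 1.1, estimate (1.5)] -/
theorem stub_decayOfSatelliteFree :
    ∀ (w : ℝ → ℝ³ → ℝ³) (q : ℝ → ℝ³ → ℝ) (C : ℝ),
      HasTypeITimeDecay C w →
      IsClassicalNSSolutionOn (Set.Iio 0) 1 0 w q →
      ∀ (l : ℝ) (R : ℝ³ ≃ₗᵢ[ℝ] ℝ³), 1 < l →
        (fun z : ℝ × ℝ³ => l • R.symm (w (l ^ 2 * z.1) (l • R z.2)))
          =ᵐ[volume.restrict (Set.Iio (0 : ℝ) ×ˢ Set.univ)] (fun z : ℝ × ℝ³ => w z.1 z.2) →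
        (∀ y : ℝ³, y ≠ l • R y → ¬ IsBackwardSingularPoint w ((0 : ℝ), y)) →
        ∃ C₀ : ℝ, HasTypeIDecay C₀ w :=
  Summit.NavierStokesRegularity.NavierStokesRegularity.Theorems.SymmetryModuliCountForcedSymmetry.stub_decayOfSatelliteFree

/-- **Stub 3c — `stub_centredWall` (VERBATIM the registered stub 3 of crux stmt-8561's line `birth` = stub 3c of the live
line; named OPEN PROBLEM: Bradshaw–Tsai 2017 OP 5.1, Tsai 2018 Conj. 8.8–8.9, Pineau–Vicol 2026 Conj. 1.1, in the class
`𝒦_C ∩ C^∞`).**  An origin-centred RDSS profile of the class WITH space–time decay is regular at the origin.  Implied by the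
canonical `TypeIDSSLiouvilleConjecture` (p142593).  Why it might fail: one decaying backward Type-I (R)DSS profile.
[cite: BradshawTsai2017CPDE, OP 5.1; Tsai2018, Conj. 8.8–8.9; PineauVicol2026, Conj. 1.1] -/
theorem stub_centredWall :
    ∀ (w : ℝ → ℝ³ → ℝ³) (q : ℝ → ℝ³ → ℝ) (H : ℝ → ℝ³ → ℝ³ →L[ℝ] ℝ³) (C : ℝ),
      IsSuitableWeakSolutionOn (slab ℝ³ (Set.Iio 0) isOpen_Iio) 1 0 w q →
      HasWeakSpatialGradientOn (slab ℝ³ (Set.Iio 0) isOpen_Iio) w H →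
      typeIBound (Set.Iio (0 : ℝ) ×ˢ Set.univ) w q H < ⊤ →
      HasTypeITimeDecay C w →
      IsClassicalNSSolutionOn (Set.Iio 0) 1 0 w q →
      ∀ (l : ℝ) (R : ℝ³ ≃ₗᵢ[ℝ] ℝ³), 1 < l →
        (fun z : ℝ × ℝ³ => l • R.symm (w (l ^ 2 * z.1) (l • R z.2)))
          =ᵐ[volume.restrict (Set.Iio (0 : ℝ) ×ˢ Set.univ)] (fun z : ℝ × ℝ³ => w z.1 z.2) →
        (∃ C₀ : ℝ, HasTypeIDecay C₀ w) →
        ¬ IsBackwardSingularPoint w 0 := by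
  sorry

/-! ## Known-type glue, proved here -/

/-- **Bridge** (landed p139433): a nonzero element of `A_C` yields a slab profile of the class singular at the origin.
[cite: AlbrittonBarker2019, Def. 2.1, Lemma 2.2, Prop. 2.3 and §3] -/
theorem stub_slabProfileOfNonzero :
    ∀ (C : ℝ) (u : ℝ → ℝ³ → ℝ³),
      IsTypeIAncientMild C u →
      (∃ t : ℝ, t < 0 ∧ ∃ x : ℝ³, u t x ≠ 0) →
      ∃ (w : ℝ → ℝ³ → ℝ³) (q : ℝ → ℝ³ → ℝ) (G : ℝ → ℝ³ → ℝ³ →L[ℝ] ℝ³) (C' : ℝ),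
        IsSuitableWeakSolutionOn (slab ℝ³ (Set.Iio 0) isOpen_Iio) 1 0 w q ∧
        HasWeakSpatialGradientOn (slab ℝ³ (Set.Iio 0) isOpen_Iio) w G ∧
        typeIBound (Set.Iio (0 : ℝ) ×ˢ Set.univ) w q G < ⊤ ∧
        HasTypeITimeDecay C' w ∧
        IsBackwardSingularPoint w 0 :=
  Summit.NavierStokesRegularity.NavierStokesRegularity.Theorems.SymmetryModuliCountForcedSymmetry.stub_slabProfileOfNonzero

/-- **Birth composition, re-keyed** (no sorry of its own; identical to `rdssLiouvilleInClass_of_birth` of the live skeleton and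
to `RDSSLiouvilleInClass_of` of `Cruxes/RDSSLiouvilleInClass/Lines/birth.lean`): stmt-8561 from stubs 3a–3c by name, after the
landed `τ`-reduction `rdssLiouvilleInClass_iff_centreTimeZero` (p138494). [cite: AlbrittonBarker2019, §1; ChaeWolf2017RemovingDSS, Thm 1.1] -/
theorem rdssLiouvilleInClass_of_birth :
    Summit.NavierStokesRegularity.NavierStokesRegularity.Theses.DulacContraction.RDSSLiouvilleInClass := by
  rw [Summit.NavierStokesRegularity.NavierStokesRegularity.Theorems.SymmetryModuliCountForcedSymmetry.rdssLiouvilleInClass_iff_centreTimeZero]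
  intro w q H C hsw hwg hI hdec hcl hinv
  obtain ⟨l, hl, R, ξ, hae⟩ := hinv
  by_cases hξ : ξ = 0
  · subst hξ
    have hae0 : (fun z : ℝ × ℝ³ => l • R.symm (w (l ^ 2 * z.1) (l • R z.2)))
        =ᵐ[volume.restrict (Set.Iio (0 : ℝ) ×ˢ Set.univ)] (fun z : ℝ × ℝ³ => w z.1 z.2) := by
      simpa only [add_zero] using hae
    have hoff : ∀ y : ℝ³, y ≠ l • R y → ¬ IsBackwardSingularPoint w ((0 : ℝ), y) := by
      intro y hy
      exact stub_satelliteExclusion w q H C hsw hwg hI hdec hcl l R 0 hl hae y (by simpa only [add_zero] using hy)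
    obtain ⟨C₀, hC₀⟩ := stub_decayOfSatelliteFree w q C hdec hcl l R hl hae0 hoff
    exact stub_centredWall w q H C hsw hwg hI hdec hcl l R hl hae0 ⟨C₀, hC₀⟩
  · have h0 : (0 : ℝ³) ≠ l • R 0 + ξ := by
      intro h
      apply hξ
      have hz : l • R (0 : ℝ³) + ξ = ξ := by simp
      rw [hz] at h
      exact h.symm
    exact stub_satelliteExclusion w q H C hsw hwg hI hdec hcl l R ξ hl hae 0 h0

/-- **Stmt-8561 by name** (`DulacContraction.RDSSLiouvilleInClass`) — a theorem of this skeleton via the birth composition. -/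
theorem stub_rdssLiouville :
    Summit.NavierStokesRegularity.NavierStokesRegularity.Theses.DulacContraction.RDSSLiouvilleInClass :=
  rdssLiouvilleInClass_of_birth

/-! Glue lemmas `rdss_vanishes_of_not_singular` and `accumulation_endpoint` of gen s1–c9.3 (the accumulation endpoint) are no
longer used by the composition (gen c9.4 registers the Liouville form of the sensitive stub); they live on in the tree as
`Theorems.SymmetryModuliCountForcedSymmetry.rdss_vanishes_of_not_singular` / `.accumulation_endpoint` (p153609) and carry the
certificate `sensitiveClosing_iff_sensitiveLiouville` (p155499). -/

/-- **Glue 3 — the orbit dichotomy (pointwise Auslander–Yorke / Akin–Auslander–Berg cut; gen c9.1, PROVED).**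
A field `u` that is uniformly recurrent under the scaling flow in `L³_loc({t ≤ 0} × ℝ³)` is EITHER almost periodic
ALONG ITS ORBIT (for every `ε`, compact `K`: relatively dense log-scales `σ` with
`sup_s ‖(u_{e^s})_{e^σ} − u_{e^s}‖_{L³(K)} ≤ ε`) OR orbit-sensitive at itself (some `δ > 0` and compact `K₁`: every
`L³_loc`-neighbourhood of `u` contains an orbit point `u_{e^σ}` and a log-time `s` with
`‖(u_{e^s})_{e^σ} − u_{e^s}‖_{L³(K₁)} > δ`).  Proof: if `u` is not orbit-sensitive it is an equicontinuity point of the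
scaling flow restricted to its orbit — for every target accuracy `(δ, K₁)` some source neighbourhood `(ε, K)` is mapped
`δ`-close along the whole orbit — and the `ε`-returns of `u` to that neighbourhood, relatively dense by uniform
recurrence, are then `δ`-almost periods of the entire orbit on `K₁`.  Pure logic over the two clauses; no measure
theory and no Navier–Stokes input (the content of Auslander–Yorke — uniformity over a minimal set — is not needed
pointwise). [cite: AuslanderYorke1980 (Tôhoku Math. J. 32, doi:10.2748/tmj/1178229634), Thm 1 (pointwise half); AkinAuslanderBerg1996] -/
theorem orbitDichotomy (u : ℝ → ℝ³ → ℝ³)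
    (hrec : ∀ ε : ℝ, 0 < ε → ∀ K : Set (ℝ × ℝ³), IsCompact K → K ⊆ Set.Iic (0 : ℝ) ×ˢ Set.univ →
      ∃ L : ℝ, 0 < L ∧ ∀ a : ℝ, ∃ σ ∈ Set.Icc a (a + L),
        eLpNorm (fun z : ℝ × ℝ³ => nsRescale (Real.exp σ) u z.1 z.2 - u z.1 z.2) 3
          (volume.restrict K) ≤ ENNReal.ofReal ε) :
    (∀ ε : ℝ, 0 < ε → ∀ K : Set (ℝ × ℝ³), IsCompact K → K ⊆ Set.Iic (0 : ℝ) ×ˢ Set.univ →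
      ∃ L : ℝ, 0 < L ∧ ∀ a : ℝ, ∃ σ ∈ Set.Icc a (a + L), ∀ s : ℝ,
        eLpNorm (fun z : ℝ × ℝ³ =>
            nsRescale (Real.exp σ) (nsRescale (Real.exp s) u) z.1 z.2 - nsRescale (Real.exp s) u z.1 z.2) 3
          (volume.restrict K) ≤ ENNReal.ofReal ε) ∨
    (∃ δ : ℝ, 0 < δ ∧ ∃ K₁ : Set (ℝ × ℝ³), IsCompact K₁ ∧ K₁ ⊆ Set.Iic (0 : ℝ) ×ˢ Set.univ ∧
      ∀ ε : ℝ, 0 < ε → ∀ K : Set (ℝ × ℝ³), IsCompact K → K ⊆ Set.Iic (0 : ℝ) ×ˢ Set.univ →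
        ∃ σ : ℝ, eLpNorm (fun z : ℝ × ℝ³ => nsRescale (Real.exp σ) u z.1 z.2 - u z.1 z.2) 3
            (volume.restrict K) ≤ ENNReal.ofReal ε ∧
          ∃ s : ℝ, ENNReal.ofReal δ < eLpNorm (fun z : ℝ × ℝ³ =>
              nsRescale (Real.exp σ) (nsRescale (Real.exp s) u) z.1 z.2 - nsRescale (Real.exp s) u z.1 z.2) 3
            (volume.restrict K₁)) := by
  by_cases hsens : ∃ δ : ℝ, 0 < δ ∧ ∃ K₁ : Set (ℝ × ℝ³), IsCompact K₁ ∧ K₁ ⊆ Set.Iic (0 : ℝ) ×ˢ Set.univ ∧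
      ∀ ε : ℝ, 0 < ε → ∀ K : Set (ℝ × ℝ³), IsCompact K → K ⊆ Set.Iic (0 : ℝ) ×ˢ Set.univ →
        ∃ σ : ℝ, eLpNorm (fun z : ℝ × ℝ³ => nsRescale (Real.exp σ) u z.1 z.2 - u z.1 z.2) 3
            (volume.restrict K) ≤ ENNReal.ofReal ε ∧
          ∃ s : ℝ, ENNReal.ofReal δ < eLpNorm (fun z : ℝ × ℝ³ =>
              nsRescale (Real.exp σ) (nsRescale (Real.exp s) u) z.1 z.2 - nsRescale (Real.exp s) u z.1 z.2) 3
            (volume.restrict K₁)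
  · exact Or.inr hsens
  · refine Or.inl fun ε hε K hK hKH => ?_
    -- `u` is an equicontinuity point of the scaling flow on its orbit, at target accuracy `(ε, K)`
    have hequi : ∃ ε' : ℝ, 0 < ε' ∧ ∃ K' : Set (ℝ × ℝ³), IsCompact K' ∧ K' ⊆ Set.Iic (0 : ℝ) ×ˢ Set.univ ∧
        ∀ σ : ℝ, eLpNorm (fun z : ℝ × ℝ³ => nsRescale (Real.exp σ) u z.1 z.2 - u z.1 z.2) 3
            (volume.restrict K') ≤ ENNReal.ofReal ε' →
          ∀ s : ℝ, eLpNorm (fun z : ℝ × ℝ³ =>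
              nsRescale (Real.exp σ) (nsRescale (Real.exp s) u) z.1 z.2 - nsRescale (Real.exp s) u z.1 z.2) 3
            (volume.restrict K) ≤ ENNReal.ofReal ε := by
      by_contra hne
      push Not at hne
      apply hsens
      refine ⟨ε, hε, K, hK, hKH, fun ε' hε' K' hK' hK'H => ?_⟩
      obtain ⟨σ, hσ, s, hs⟩ := hne ε' hε' K' hK' hK'H
      exact ⟨σ, hσ, s, hs⟩
    obtain ⟨ε', hε', K', hK', hK'H, hball⟩ := hequi
    -- the `ε'`-returns of `u` to the source neighbourhood are relatively dense
    obtain ⟨L, hL, hret⟩ := hrec ε' hε' K' hK' hK'H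
    refine ⟨L, hL, fun a => ?_⟩
    obtain ⟨σ, hσ, hclose⟩ := hret a
    exact ⟨σ, hσ, hball σ hclose⟩

/-! ## Composition: the registered stubs prove the crux BY NAME -/

/-- The route target `X` from the registered stubs: a nonzero `u ∈ A_C` gives a singular slab profile (bridge), hence a
uniformly recurrent singular one `U` (`recurrentReduction_proof`, stmt-1590).  If `U` is rotated-discretely self-similar
in stmt-8561's sense, its classical representative (`classicalRepresentative_of_rdssProfile`, landed) contradicts
stmt-8561 (`stub_rdssLiouville`, from stubs 3a–3c).  Otherwise the hull of `U` is minimal (`stub_hullMinimal`) and, by the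
PROVED `orbitDichotomy`, either the scaling orbit of `U` is almost periodic along itself — then so is every hull point
(`stub_hullAlmostPeriodic`) and `stub_almostPeriodicHullLiouville` makes `U` regular — or `U` is orbit-sensitive on some
compact `K₁`, hence on `Q(0,1)` (`stub_sensitivityNormalization`, landed), hence every hull point is (`stub_hullSensitive`,
half the constant), and `stub_sensitiveHullLiouville` makes `U` regular.  Contradiction in every branch. -/
theorem typeIAncientLiouville_of_line :
    Summit.NavierStokesRegularity.NavierStokesRegularity.Theses.SymmetryModuliCount.TypeIAncientLiouville := by
  intro C u hu t ht x
  by_contra hx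
  have hu' : IsTypeIAncientMild C u := isTypeIAncientMild_iff.2 hu
  obtain ⟨w, q, G, C', hw, hG, hI, hC', hsing⟩ := stub_slabProfileOfNonzero C u hu' ⟨t, ht, x, hx⟩
  obtain ⟨U, P, H, hU, hH, hIU, hCU, hsingU, hrecU⟩ :=
    Summit.NavierStokesRegularity.NavierStokesRegularity.Theorems.recurrentReduction_proof w q G C' hw hG hI hC' hsing
  -- the periodic case: `U` rotated-discretely self-similar in stmt-8561's sense
  by_cases hper : ∃ l : ℝ, 1 < l ∧ ∃ (R : ℝ³ ≃ₗᵢ[ℝ] ℝ³) (ξ : ℝ³) (τ : ℝ), τ ≤ 0 ∧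
      (fun z : ℝ × ℝ³ => l • R.symm (U (l ^ 2 * z.1 + τ) (l • R z.2 + ξ)))
        =ᵐ[volume.restrict (Set.Iio (0 : ℝ) ×ˢ Set.univ)] (fun z : ℝ × ℝ³ => U z.1 z.2)
  · obtain ⟨w', q', H', C'', h1, h2, h3, h4, h5, h6, h7⟩ :=
      Summit.NavierStokesRegularity.NavierStokesRegularity.Theorems.SymmetryModuliCountForcedSymmetry.classicalRepresentative_of_rdssProfile
        hU hIU hCU hper hsingU
    exact stub_rdssLiouville w' q' H' C'' h1 h2 h3 h4 h5 h6 h7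
  -- the aperiodic case: `U ∈ L³_loc`, its hull is minimal
  have hPU : ∀ R : ℝ, 0 < R → MemLp (uncurry U) 3 (volume.restrict (parabolicCylinder R (0 : ℝ × ℝ³))) :=
    fun R hR => Summit.NavierStokesRegularity.NavierStokesRegularity.Theorems.memLp_three_of_slabProfile hH hIU hR
  have hmin : ∀ V : ℝ → ℝ³ → ℝ³,
      (∀ R : ℝ, 0 < R → MemLp (uncurry V) 3 (volume.restrict (parabolicCylinder R (0 : ℝ × ℝ³)))) →
      (∀ ε : ℝ, 0 < ε → ∀ K : Set (ℝ × ℝ³), IsCompact K → K ⊆ Set.Iic (0 : ℝ) ×ˢ Set.univ →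
        ∃ τ : ℝ, eLpNorm (fun z : ℝ × ℝ³ => nsRescale (Real.exp τ) U z.1 z.2 - V z.1 z.2) 3
          (volume.restrict K) ≤ ENNReal.ofReal ε) →
      ∀ ε : ℝ, 0 < ε → ∀ K : Set (ℝ × ℝ³), IsCompact K → K ⊆ Set.Iic (0 : ℝ) ×ˢ Set.univ →
        ∃ τ : ℝ, eLpNorm (fun z : ℝ × ℝ³ => nsRescale (Real.exp τ) V z.1 z.2 - U z.1 z.2) 3
          (volume.restrict K) ≤ ENNReal.ofReal ε :=
    fun V hPV hUV => stub_hullMinimal U V hPU hPV hrecU hUV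
  -- the orbit dichotomy
  rcases orbitDichotomy U hrecU with hap | hsensK
  · -- almost-periodic branch: the hull is an equicontinuous minimal set
    refine stub_almostPeriodicHullLiouville U P H C' hU hH hIU hCU hap hper (fun V hPV hUV => ?_) hsingU
    exact ⟨hmin V hPV hUV, stub_hullAlmostPeriodic U V hPU hPV hap hUV⟩
  · -- sensitive branch: normalise to `Q(0,1)`, propagate over the hull, then the sensitive Liouville stub
    obtain ⟨δ, hδ, hOS⟩ := stub_sensitivityNormalization U hsensK
    refine stub_sensitiveHullLiouville U P H C' hU hH hIU hCU hrecU hper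
      ⟨δ / 2, by positivity, fun V hPV hUV => ?_⟩ hsingU
    exact ⟨hmin V hPV hUV, stub_hullSensitive U δ hδ hPU hmin hOS V hPV hUV⟩

/-- **The line concludes the crux BY NAME.**  `ForcedSymmetry` from the registered stubs, via the route target `X`
(`typeIAncientLiouville_of_line`) and the landed collapse direction `forcedSymmetry_of_typeIAncientLiouville`. -/
theorem ForcedSymmetry_of :
    Summit.NavierStokesRegularity.NavierStokesRegularity.Theses.SymmetryModuliCount.ForcedSymmetry :=
  Summit.NavierStokesRegularity.NavierStokesRegularity.Theorems.forcedSymmetry_of_typeIAncientLiouville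
    typeIAncientLiouville_of_line

end Summit.NavierStokesRegularity.NavierStokesRegularity.Cruxes.ForcedSymmetry.ClosingDichotomy

end
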